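import Literature.AlgebraicGeometry.Motives.HodgeThetaSubalgebraUnitaryAnnihilatorIdealTop
import Literature.AlgebraicGeometry.Motives.HodgeThetaSubalgebraUnitaryFourTwoSkeleton
import Literature.AlgebraicGeometry.Motives.HodgeThetaSubalgebraUnitaryFourTwoBlockUnits
import HarnessLib

/-!
# The `(2,4)` unitary core in TENSOR-DATA form: an irreducible involutive linear Lie algebra `𝔊 ∋ 1, T` on `W = P ⊕ Q`
# (`T² = 1`, `dim P = 2`, `dim Q = 4`) is either ALL of `End(W)`, or `W ≅ ℂ² ⊗ ℂ³` with `𝔊 = 𝔤𝔩₂ ⊗ 1 + 1 ⊗ 𝔤𝔩₃` and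
# `T = 1 ⊗ diag(1,−1,−1)` — stated by commuting systems of `2 × 2` and `3 × 3` MATRIX UNITS inside `𝔊`
# (Moonen–Zarhin 1999 (2.3)–(2.5) for the pair `(2,4)`, classification-free)

Family `hodge`, layer `Literature/AlgebraicGeometry/Motives` (pure complex linear algebra; no geometry; no Hodge theory).
Written for the cell `pub-hodgeav-hg6` (req-37 (A) row 2 «base of HC ladder»; lead g2 coordination item 2026-08-28 23:16Z «export
the skeleton branch as a standalone theorem in tensor-data form, not only the radical-vector form»): the dichotomy of bricks V1
(`UnitaryFourTwo.eq_top_of_annP_irreducible`), V3 (`UnitaryFourTwo.exists_matrix_units`) and V3b (`UnitaryFourTwo.exists_block_units`)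
packaged with `Fin`-indexed matrix units — exactly the hypothesis list of brick V4 `UnitaryFourTwo.tensorSkeleton_radical` (whence
the radical-vector form `UnitaryThetaCore.top_or_radical_two_four`) and the unit data consumed by the Segre-compression return leg of
the rank-`12` programme (`HodgeThetaSubalgebraTensorSkeletonSegre`). Honest framing of the cell: HC / HC_AV / HC_CM / H2 are NOT
proved — this file is unconditional linear algebra. UNCONDITIONAL; one theorem — no definition, no named fact (D-0026), no `sorry`.

## References
* [MoonenZarhin1999LowDim] B. Moonen, Yu. Zarhin, *Hodge classes on abelian varieties of low dimension*, Math. Ann. 315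
  (1999), §2 (2.3)–(2.5).
* [Humphreys1972] J. E. Humphreys, *Introduction to Lie Algebras and Representation Theory*, §5.1.
-/

noncomputable section

open Module

namespace Literature.AlgebraicGeometry.Motives

namespace HodgeStructure

/-- **The `(2,4)` unitary core, tensor-data form.** Let `𝔊 ⊆ End_ℂ(W)` be closed under the commutator, contain `1` and an
involution `T` (`T² = 1`) with eigenspaces `P` (`+1`, `dim 2`) and `Q` (`−1`, `dim 4`), and act irreducibly on `W`. Then either
`𝔊 = End(W)`, or there are COMMUTING SYSTEMS OF MATRIX UNITS `p_ab` (`a, b ∈ Fin 2`: `p_ab p_cd = δ_bc p_ad`, `p₀₀ + p₁₁ = 1`) and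
`u_ij` (`i, j ∈ Fin 3`: `u_ij u_kl = δ_jk u_il`, `u₀₀ + u₁₁ + u₂₂ = 1`) in `𝔊`, with `tr_W(p₀₀u₀₀) = 1` (so `W ≅ ℂ² ⊗ ℂ³`),
`𝔊 = Σ ℂ p_ab + Σ ℂ u_ij` (`= 𝔤𝔩₂ ⊗ 1 + 1 ⊗ 𝔤𝔩₃`) and `T = u₀₀ − u₁₁ − u₂₂` (`= 1 ⊗ diag(1,−1,−1)`).
[cite: MoonenZarhin1999LowDim, §2 (2.3)–(2.5)] -/
theorem UnitaryThetaCore.top_or_tensorSkeleton_two_four {W : Type*} [AddCommGroup W] [Module ℂ W] [FiniteDimensional ℂ W]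
    {𝔊 : Submodule ℂ (Module.End ℂ W)} (hbr : ∀ F ∈ 𝔊, ∀ G ∈ 𝔊, F * G - G * F ∈ 𝔊) (h1 : (1 : Module.End ℂ W) ∈ 𝔊)
    (hirr : ∀ U : Submodule ℂ W, (∀ F ∈ 𝔊, ∀ u ∈ U, F u ∈ U) → U = ⊥ ∨ U = ⊤)
    {T : Module.End ℂ W} (hT : T ∈ 𝔊) (hTT : T * T = 1) {P Q : Submodule ℂ W}
    (hP : ∀ x, x ∈ P ↔ T x = x) (hQ : ∀ x, x ∈ Q ↔ T x = -x)
    (h2 : Module.finrank ℂ P = 2) (h4 : Module.finrank ℂ Q = 4) :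
    𝔊 = ⊤ ∨
    ∃ (p : Fin 2 → Fin 2 → Module.End ℂ W) (u : Fin 3 → Fin 3 → Module.End ℂ W),
      (∀ a b c d, p a b * p c d = if b = c then p a d else 0) ∧ p 0 0 + p 1 1 = 1 ∧
      (∀ i j k l, u i j * u k l = if j = k then u i l else 0) ∧ u 0 0 + u 1 1 + u 2 2 = 1 ∧
      (∀ a b i j, p a b * u i j = u i j * p a b) ∧ LinearMap.trace ℂ W (p 0 0 * u 0 0) = 1 ∧
      (∀ a b, p a b ∈ 𝔊) ∧ (∀ i j, u i j ∈ 𝔊) ∧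
      (∀ X ∈ 𝔊, ∃ (s : Fin 2 → Fin 2 → ℂ) (c : Fin 3 → Fin 3 → ℂ),
        X = (∑ a, ∑ b, s a b • p a b) + ∑ i, ∑ j, c i j • u i j) ∧
      T = u 0 0 - u 1 1 - u 2 2 := by
  by_cases hNirr : ∀ U : Submodule ℂ W, U ≤ Q →
      (∀ X ∈ 𝔊, X * T = T * X → (∀ p ∈ P, X p = 0) → ∀ u ∈ U, X u ∈ U) → U = ⊥ ∨ U = Q
  · exact Or.inl (UnitaryFourTwo.eq_top_of_annP_irreducible hbr h1 hirr hT hTT hP hQ h2 (by rw [h4]; norm_num) hNirr)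
  right
  push Not at hNirr
  obtain ⟨U₀, hU₀Q, hU₀st, hU₀ne, hU₀neQ⟩ := hNirr
  -- brick V3: the `3 × 3` matrix units
  obtain ⟨e, C, E₁, E₂, U, V, ⟨he, hC, hE₁, hE₂, hU, hV, heU, hVC⟩,
      ⟨hCe, hCE₁, hCV, hE₁e, hE₁E₁, hE₁V, hUe, hUE₁, hUV⟩, ⟨heE₁, hVE₁, hE₁C, hE₁U, hVU, hunits, hTeq, hr₁⟩,
      hdec, hfull⟩ :=
    UnitaryFourTwo.exists_matrix_units hbr h1 hirr hT hTT hP hQ h2 h4 ⟨U₀, hU₀Q, hU₀ne, hU₀neQ, hU₀st⟩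
  have hunits' : e * C + E₁ + V * U = 1 := by rw [hVU]; exact hunits
  -- brick V3b: the `2 × 2` matrix units in the centraliser
  obtain ⟨P₁₁, P₁₂, P₂₁, P₂₂, ⟨hP₁₁, hP₁₂, hP₂₁, hP₂₂⟩, hPcomm, ⟨m1, m2, m3, m4, m5, m6, m7, m8⟩,
      ⟨z1, z2, z3, z4, z5, z6, z7, z8⟩, hPsum, htrPE, hPspan⟩ :=
    UnitaryFourTwo.exists_block_units (𝔊 := 𝔊) heE₁ hVE₁ hE₁C hE₁U hE₁E₁ hunits' hr₁ hfull
  -- the tensor skeleton handed to brick V4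
  set F : Fin 3 → Module.End ℂ W := ![e, E₁, V] with hFdef
  set G : Fin 3 → Module.End ℂ W := ![C, E₁, U] with hGdef
  set u : Fin 3 → Fin 3 → Module.End ℂ W := fun i j => F i * G j with hudef
  set p : Fin 2 → Fin 2 → Module.End ℂ W := fun a b => ![![P₁₁, P₁₂], ![P₂₁, P₂₂]] a b with hpdef
  have hGF : ∀ j k, G j * F k = if j = k then E₁ else 0 := by
    intro j k
    fin_cases j <;> fin_cases k <;> simp [hFdef, hGdef, hCe, hCE₁, hCV, hE₁e, hE₁E₁, hE₁V, hUe, hUE₁, hUV]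
  have hFE : ∀ i, F i * E₁ = F i := by
    intro i; fin_cases i
    · exact heE₁
    · exact hE₁E₁
    · exact hVE₁
  have hEG : ∀ j, E₁ * G j = G j := by
    intro j; fin_cases j
    · exact hE₁C
    · exact hE₁E₁
    · exact hE₁U
  have hu : ∀ i j k l, u i j * u k l = if j = k then u i l else 0 := by
    intro i j k l
    change F i * G j * (F k * G l) = if j = k then F i * G l else 0
    rw [mul_assoc, ← mul_assoc (G j), hGF]
    by_cases hjk : j = k
    · rw [if_pos hjk, if_pos hjk, hEG]
    · rw [if_neg hjk, if_neg hjk, zero_mul, mul_zero]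
  have husum : u 0 0 + u 1 1 + u 2 2 = 1 := by
    change F 0 * G 0 + F 1 * G 1 + F 2 * G 2 = 1
    simp only [hFdef, hGdef, Matrix.cons_val_zero, Matrix.cons_val_one, Matrix.head_cons, Matrix.cons_val_two,
      Matrix.tail_cons, hE₁E₁]
    exact hunits'
  have hp : ∀ a b c d, p a b * p c d = if b = c then p a d else 0 := by
    intro a b c d
    fin_cases a <;> fin_cases b <;> fin_cases c <;> fin_cases d <;>
      simp [hpdef, m1, m2, m3, m4, m5, m6, m7, m8, z1, z2, z3, z4, z5, z6, z7, z8]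
  have hpsum : p 0 0 + p 1 1 = 1 := by
    change P₁₁ + P₂₂ = 1
    exact hPsum
  have hPc : ∀ a b, p a b * e = e * p a b ∧ p a b * C = C * p a b ∧ p a b * E₁ = E₁ * p a b ∧
      p a b * U = U * p a b ∧ p a b * V = V * p a b := by
    intro a b
    apply hPcomm
    fin_cases a <;> fin_cases b <;> simp [hpdef]
  have hPF : ∀ a b i, p a b * F i = F i * p a b := by
    intro a b i
    obtain ⟨h₁, -, h₃, -, h₅⟩ := hPc a b
    fin_cases i
    · exact h₁
    · exact h₃
    · exact h₅
  have hPG : ∀ a b j, p a b * G j = G j * p a b := by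
    intro a b j
    obtain ⟨-, h₂, h₃, h₄, -⟩ := hPc a b
    fin_cases j
    · exact h₂
    · exact h₃
    · exact h₄
  have hcomm : ∀ a b i j, p a b * u i j = u i j * p a b := by
    intro a b i j
    change p a b * (F i * G j) = F i * G j * p a b
    rw [← mul_assoc, hPF, mul_assoc, hPG, mul_assoc]
  have htr : LinearMap.trace ℂ W (p 0 0 * u 0 0) = 1 := by
    change LinearMap.trace ℂ W (P₁₁ * (F 0 * G 0)) = 1
    simp only [hFdef, hGdef, Matrix.cons_val_zero]
    have hCP : C * P₁₁ = P₁₁ * C := (hPc 0 0).2.1.symm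
    rw [← mul_assoc, LinearMap.trace_mul_comm, ← mul_assoc, hCP, mul_assoc, hCe]
    exact htrPE
  have heC : e * C ∈ 𝔊 := by
    have h : e * C = 1 - E₁ - V * U := by rw [← hunits']; abel
    rw [h]
    exact 𝔊.sub_mem (𝔊.sub_mem h1 hE₁) (hVU ▸ hE₂)
  have hp𝔊 : ∀ a b, p a b ∈ 𝔊 := by
    intro a b
    fin_cases a <;> fin_cases b
    · exact hP₁₁
    · exact hP₁₂
    · exact hP₂₁
    · exact hP₂₂
  have hu𝔊 : ∀ i j, u i j ∈ 𝔊 := by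
    intro i j
    fin_cases i <;> fin_cases j
    · exact heC
    · change e * E₁ ∈ 𝔊; rw [heE₁]; exact he
    · exact heU
    · change E₁ * C ∈ 𝔊; rw [hE₁C]; exact hC
    · change E₁ * E₁ ∈ 𝔊; rw [hE₁E₁]; exact hE₁
    · change E₁ * U ∈ 𝔊; rw [hE₁U]; exact hU
    · exact hVC
    · change V * E₁ ∈ 𝔊; rw [hVE₁]; exact hV
    · change V * U ∈ 𝔊; rw [hVU]; exact hE₂
  have hG : ∀ X ∈ 𝔊, ∃ (s : Fin 2 → Fin 2 → ℂ) (c : Fin 3 → Fin 3 → ℂ),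
      X = (∑ a, ∑ b, s a b • p a b) + ∑ i, ∑ j, c i j • u i j := by
    intro X hX
    obtain ⟨c₁₁, c₁₂, c₁₃, c₂₁, c₂₂, c₂₃, c₃₁, c₃₂, c₃₃, S, -, ⟨hSe, hSC, hSE, hSU, hSV⟩, hX'⟩ := hdec X hX
    obtain ⟨s₁₁, s₁₂, s₂₁, s₂₂, hS⟩ := hPspan S hSe hSC hSE hSU hSV
    refine ⟨![![s₁₁, s₁₂], ![s₂₁, s₂₂]], ![![c₁₁, c₁₂, c₁₃], ![c₂₁, c₂₂, c₂₃], ![c₃₁, c₃₂, c₃₃]], ?_⟩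
    simp only [hudef, hpdef, hFdef, hGdef, Fin.sum_univ_two, Fin.sum_univ_three, Matrix.cons_val_zero,
      Matrix.cons_val_one, Matrix.head_cons, Matrix.cons_val_two, Matrix.tail_cons, heE₁, hE₁C, hE₁E₁, hE₁U, hVE₁]
    rw [hX', hS]
    abel
  have hTu : u 0 0 - u 1 1 - u 2 2 = T := by
    change F 0 * G 0 - F 1 * G 1 - F 2 * G 2 = T
    simp only [hFdef, hGdef, Matrix.cons_val_zero, Matrix.cons_val_one, Matrix.head_cons, Matrix.cons_val_two,
      Matrix.tail_cons, hE₁E₁, hVU, hTeq]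
  exact ⟨p, u, hp, hpsum, hu, husum, hcomm, htr, hp𝔊, hu𝔊, hG, hTu.symm⟩

end HodgeStructure

end Literature.AlgebraicGeometry.Motives
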